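import Literature.AlgebraicGeometry.Motives.GrassmannianSchemeProper
import Mathlib.AlgebraicGeometry.Morphisms.Smooth
import Mathlib.AlgebraicGeometry.Morphisms.UniversallyOpen
import HarnessLib

/-!
# The Grassmannian scheme is smooth over `ℤ`

Topic `AlgebraicGeometry/Motives`; namespace `Literature.AlgebraicGeometry.Motives.Grassmannian`.  THEOREMS ONLY
(no definition, no instance, no notation, no named fact, no `sorry`).  (h4) brick (A8) of the cell's F-DAG hand
«Grassmannian as a scheme», second half of [GortzWedhorn2020, Cor. 8.15 (p. 216)]: `Grass_{d,n} → Spec ℤ` is smooth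
(covered by the open affine spaces `U_I ≅ 𝔸^{d(n-d)}_ℤ`).

Road: smoothness is Zariski-local on the source (Mathlib `IsZariskiLocalAtSource @Smooth`); over the chart cover
★ `exists_openImmersion_chartScheme_cover` ((A7), `GrassmannianSchemeProper`) each chart is
`Spec ℤ[X_{σ_I × Fin k}] → Spec ℤ`, i.e. `Spec` of the SMOOTH ring map `ℤ → ℤ[X_σ]` (`σ` finite: Mathlib
`instFormallySmoothMvPolynomial` + `Algebra.FinitePresentation.mvPolynomial`), read through
`HasRingHomProperty.Spec_iff (P := @Smooth)` exactly as in (A7) §2 for `LocallyOfFiniteType`.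

* **`smooth_terminal_from : Smooth (terminal.from (grassmannianScheme M k))`** (`M` finite free), and the Mathlib
  corollaries `locallyOfFinitePresentation_terminal_from`, `flat_terminal_from`, `universallyOpen_terminal_from`.

Not here: the relative dimension `k (n - k)` (Mathlib has no standard-smooth-of-relative-dimension instance for
polynomial algebras yet).  References: [GortzWedhorn2020] Cor. 8.15 (p. 216); [StacksProject, Tag 089T].  Cell
`hodgecm-mathlib` (D-0151), count-neutral Mathlib-side capital; nothing here is about HC — HC_CM is proved only modulo
the 7 printed citations until rung 0 closes.
-/

universe u

open CategoryTheory CategoryTheory.Limits Opposite _root_.AlgebraicGeometry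

namespace Literature.AlgebraicGeometry.Motives.Grassmannian

section Smooth

variable (M : Type u) [AddCommGroup M] (k : ℕ) [(grassmannianSheaf M k).obj.IsRepresentable]

/-- The polynomial ring `ℤ[X_σ]` on a finite `σ` is a smooth `ℤ`-algebra. [folklore] -/
private theorem smooth_mvPolynomial_int (σ : Type u) [Finite σ] : Algebra.Smooth ℤ (MvPolynomial σ ℤ) :=
  { }

/-- The structure morphism `Spec ℤ[X_σ] → ⊤` of a chart is smooth for `σ` finite. [folklore] -/
private theorem smooth_terminal_from_chartScheme {J : Type u} [Finite J] (k : ℕ) (I : Fin k → J) :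
    Smooth (terminal.from (chartScheme k I)) := by
  have := isIso_of_isTerminal specULiftZIsTerminal.{u} terminalIsTerminal (terminal.from _)
  let φ : ULift.{u} ℤ →+* MvPolynomial ({j : J // j ∉ Set.range I} × Fin k) ℤ :=
    (algebraMap ℤ _).comp ULift.ringEquiv.toRingHom
  change Smooth (terminal.from (Spec (CommRingCat.of (MvPolynomial _ ℤ))))
  rw [← terminal.comp_from (Spec.map (CommRingCat.ofHom φ)),
    MorphismProperty.cancel_right_of_respectsIso (P := @Smooth),
    HasRingHomProperty.Spec_iff (P := @Smooth)]
  change φ.Smooth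
  haveI := smooth_mvPolynomial_int ({j : J // j ∉ Set.range I} × Fin k)
  exact RingHom.Smooth.comp (RingHom.Smooth.of_bijective ULift.ringEquiv.bijective)
    (RingHom.smooth_algebraMap.mpr inferInstance)

variable [Module.Finite ℤ M] [Module.Free ℤ M]

/-- **THE GRASSMANNIAN IS SMOOTH OVER `ℤ`**: for a finite free abelian group `M` and `k : ℕ`, the structure morphism
`grassmannianScheme M k → ⊤ = Spec ℤ` is smooth (Zariski-locally on the source over the chart cover by affine spaces
`Spec ℤ[X_{σ_I × Fin k}]`, each smooth over `ℤ`). [cite: GortzWedhorn2020, Cor. 8.15 (p. 216)] [cite: StacksProject, Tag 089T] -/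
theorem smooth_terminal_from : Smooth (terminal.from (grassmannianScheme M k)) := by
  obtain ⟨g, hg, hcov, -⟩ :=
    exists_openImmersion_chartScheme_cover k M (Module.Free.chooseBasis ℤ M)
  let 𝒰 : (grassmannianScheme M k).OpenCover :=
    Scheme.Cover.mkOfCovers {I : Fin k → Module.Free.ChooseBasisIndex ℤ M // Function.Injective I}
      (fun I => chartScheme k I.1) g (fun y => by
        obtain ⟨I, z, hz⟩ := hcov y
        exact ⟨I, z, hz⟩) hg
  refine IsZariskiLocalAtSource.of_openCover 𝒰 fun I => ?_
  rw [terminal.comp_from]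
  exact smooth_terminal_from_chartScheme k I.1

/-- `grassmannianScheme M k → ⊤` is locally of finite presentation (smooth morphisms are).
[cite: GortzWedhorn2020, Cor. 8.15 (p. 216)] -/
theorem locallyOfFinitePresentation_terminal_from :
    LocallyOfFinitePresentation (terminal.from (grassmannianScheme M k)) := by
  haveI := smooth_terminal_from M k
  infer_instance

/-- `grassmannianScheme M k → ⊤` is flat (smooth morphisms are). [cite: GortzWedhorn2020, Cor. 8.15 (p. 216)] -/
theorem flat_terminal_from : Flat (terminal.from (grassmannianScheme M k)) := by
  haveI := smooth_terminal_from M k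
  infer_instance

/-- `grassmannianScheme M k → ⊤` is universally open (flat and locally of finite presentation).
[cite: GortzWedhorn2020, Cor. 8.15 (p. 216)] -/
theorem universallyOpen_terminal_from : UniversallyOpen (terminal.from (grassmannianScheme M k)) := by
  haveI := smooth_terminal_from M k
  infer_instance

end Smooth

end Literature.AlgebraicGeometry.Motives.Grassmannian
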